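import Mathlib
import Literature.NumberTheory.LFunctions.Zhang2022.Section8Lemma84Estimate
import Literature.NumberTheory.LFunctions.Zhang2022.TypedSection12B
import HarnessLib

/-!
# Zhang (2022) §12 u030: the residue at the kernel pole against the model term `L′(1,χ)Π·(s+β_a)(s+β_b)/s`

Topic `Literature/NumberTheory/LFunctions/Zhang2022` (Landau–Siegel audit tree; verdict-neutral).
Y. Zhang, *Discrete mean estimates and the Landau–Siegel zero*, arXiv:2211.02515v1 (2022)
[Zhang2022LandauSiegel] — **an unrefereed manuscript under adjudication**; ZHANG-L lane WP12, helper
under the RT-02 node hTop25Ex (core `Typed.Sec12B.U030`, §12 p.70). Nothing here asserts or denies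
Theorems 1–2 of the manuscript.

In the contour evaluation of the smoothed sum `Σ_l χ(l)ξ_j(l;d,r)l^{−(1−β₆+w)}g(x/l)` (tree:
`Lemma84.smoothedSeries_sub_residues_le`, `Section12U030Contour`) the residue at the kernel's pole is
`Φ(0) = 𝒰(s₀)L(s₀+β_{j+1},χ)L(s₀+β_{j+2},χ)/L(s₀,χ)`, `s₀ = 1 − β₆ + w`. THIS FILE compares it with
the model `L′(1,χ)Π(d,r)(s+β_{j+1})(s+β_{j+2})/s`, `s = w − β₆` (`α/2 ≤ |s| ≤ 5α/2` for `|w| = α`),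
exactly as the tree's `Lemma84.norm_Phi_sub_model_le` does on the small rectangle of Lemma 8.4:
Lemma 5.8 for the three `L`-values (`Lemma58.lemma_5_8_of_le`), Lemma 8.3 (iii′) for `𝒰 − Π`
(relative form, weight `Π̂ = ∏_{q∣dr}(1−q⁻¹)⁻¹`), and the algebra `Lemma84.norm_quot_sub_model_le`:

  `‖Φ(0) − L′(1,χ)Π(s+β_a)(s+β_b)/s‖ ≤ Π̂²E(24K²+2K) + 32K³E_U·2e^{9/2}(1+𝓛)𝓛·α`

(`E = (1+16e^{9/2}π²K²)𝓛⁻¹⁵`, `E_U = C₈₃𝓛⁻⁸Π̂`, `K ≥ 7 + 15|c′|`). Proved; 0 definitions.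

## References

* Y. Zhang, arXiv:2211.02515v1 (2022), §12 p.70 (proof of Lemma 12.3); §8 proof of Lemma 8.4 p.47
  ("By Lemma 5.8 and 8.3 … O(𝓛⁻¹⁵)"). [cite: Zhang2022LandauSiegel, §12 p.70; §8 Lemma 8.4]
-/

noncomputable section

open Complex Real

namespace Literature.NumberTheory.LFunctions.Zhang2022.Lemma84

open Literature.NumberTheory.LFunctions.Zhang2022.Skeleton

section ResidueOne

variable {D : ℕ} [NeZero D] (χ : DirichletCharacter ℂ D) (c' : ℝ)

omit [NeZero D] in
/-- `α/2 ≤ |w − β₆| ≤ 5α/2` for `|w| = α` (`β₆ = 3iα/2`). [cite: Zhang2022LandauSiegel, §12 p.70] -/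
theorem norm_w_sub_beta6_bounds (h𝓛 : 3 ≤ Real.log D) {w : ℂ} (hw : ‖w‖ = alpha D) :
    alpha D / 2 ≤ ‖w - beta6 D‖ ∧ ‖w - beta6 D‖ ≤ 5 * alpha D / 2 := by
  have hα0 : 0 < alpha D := alpha_pos' (by rw [ell]; linarith)
  have hb : ‖beta6 D‖ = 3 * alpha D / 2 := by
    rw [beta6]; simp [Complex.norm_real, abs_of_pos hα0]
  constructor
  · have h := norm_sub_norm_le (beta6 D) w
    rw [norm_sub_rev] at h
    rw [hb, hw] at h
    linarith
  · calc ‖w - beta6 D‖ ≤ ‖w‖ + ‖beta6 D‖ := norm_sub_le _ _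
      _ = 5 * alpha D / 2 := by rw [hw, hb]; ring

/-- **The residue at the kernel pole against the model.** With the hypotheses of
`Lemma84.norm_Phi_sub_model_le` ((A), `K ≥ 7+15|c′|`, `Kπ ≤ 𝓛⁸`, `0 < ℓ₀ ≤ |L′(1,χ)|`,
`E ≤ ℓ₀α/4`, Lemma 8.3 (iii′) in the relative form) and `|w| = α`:
`‖𝒰(s₀)L(s₀+β_{j+1})L(s₀+β_{j+2})/L(s₀) − L′(1,χ)Π(d,r)(s+β_{j+1})(s+β_{j+2})/s‖ ≤
Π̂²E(24K²+2K) + 32K³(C₈₃𝓛⁻⁸Π̂)(2e^{9/2}(1+𝓛)𝓛)α` (`s₀ = 1−β₆+w`, `s = w−β₆`).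
[cite: Zhang2022LandauSiegel, §12 p.70 (proof of Lemma 12.3); §8 Lemma 8.4 (proof)] -/
theorem norm_resOne_sub_model_le (hprim : χ.IsPrimitive) (h𝓛 : 3 ≤ Real.log D)
    (hA : ‖χ.LFunction 1‖ ≤ 1 / Real.log D ^ 2022) (j : ℕ) {d r : ℕ} (hd : d ≠ 0) (hr : r ≠ 0)
    (U : ℂ → ℂ) {C₈₃ K ℓ₀ : ℝ} (hC₈₃ : 0 ≤ C₈₃) (hK : 7 + 15 * |c'| ≤ K)
    (hKL : K * π ≤ Real.log D ^ 8) (hℓ₀ : 0 < ℓ₀) (hℓ : ℓ₀ ≤ ‖deriv χ.LFunction 1‖)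
    (hE : (1 + 16 * Real.exp (9 / 2) * π ^ 2 * K ^ 2) / Real.log D ^ 15 ≤ ℓ₀ * alpha D / 4)
    (hU3 : ∀ s : ℂ, ‖s - 1‖ ≤ 5 * alpha D → ‖U s - PiW χ d r‖ ≤
      C₈₃ * (ell D ^ 8)⁻¹ * ∏ q ∈ (d * r).primeFactors, (1 - (q : ℝ)⁻¹)⁻¹)
    {w : ℂ} (hw : ‖w‖ = alpha D) :
    ‖U (1 - beta6 D + w) * χ.LFunction (1 - beta6 D + w + betaJ c' D (j + 1)) *
          χ.LFunction (1 - beta6 D + w + betaJ c' D (j + 2)) / χ.LFunction (1 - beta6 D + w) -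
        deriv χ.LFunction 1 * PiW χ d r *
          ((w - beta6 D + betaJ c' D (j + 1)) * (w - beta6 D + betaJ c' D (j + 2)) / (w - beta6 D))‖ ≤
      (∏ q ∈ (d * r).primeFactors, (1 - (q : ℝ)⁻¹)⁻¹) ^ 2 *
          ((1 + 16 * Real.exp (9 / 2) * π ^ 2 * K ^ 2) / Real.log D ^ 15) * (24 * K ^ 2 + 2 * K) +
        32 * K ^ 3 * (C₈₃ * (ell D ^ 8)⁻¹ * ∏ q ∈ (d * r).primeFactors, (1 - (q : ℝ)⁻¹)⁻¹) *
          (2 * Real.exp (9 / 2) * (1 + Real.log D) * Real.log D) * alpha D := by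
  set 𝓛 : ℝ := Real.log D with h𝓛def
  set α : ℝ := alpha D with hαdef
  set βa : ℂ := betaJ c' D (j + 1) with hβadef
  set βb : ℂ := betaJ c' D (j + 2) with hβbdef
  set hatPi : ℝ := ∏ q ∈ (d * r).primeFactors, (1 - (q : ℝ)⁻¹)⁻¹ with hhatPi
  set E : ℝ := (1 + 16 * Real.exp (9 / 2) * π ^ 2 * K ^ 2) / 𝓛 ^ 15 with hEdef
  set ℓ : ℂ := deriv χ.LFunction 1 with hℓdef
  have hℓ2 : 2 ≤ ell D := by rw [ell]; linarith
  have hα0 : 0 < α := alpha_pos' (by linarith)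
  have hαeq : α = π / 𝓛 ^ 9 := alpha_eq D
  have hαℓ : α * ell D ≤ 1 := alpha_mul_ell_le_one hℓ2
  have hK1 : 1 ≤ K := by linarith [abs_nonneg c']
  -- the variable `s = w − β₆`
  set s : ℂ := w - beta6 D with hsdef
  obtain ⟨hs_lo, hs_hi⟩ := norm_w_sub_beta6_bounds h𝓛 hw
  rw [← hsdef, ← hαdef] at hs_lo hs_hi
  have h1s : 1 - beta6 D + w = 1 + s := by rw [hsdef]; ring
  -- sizes of the shifts
  have hβ : ∀ i : ℕ, ‖betaJ c' D i‖ ≤ 3 * α * (1 + 5 * |c'|) := by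
    intro i
    have h := norm_betaJ_le c' D i hα0.le (by linarith : 0 ≤ ell D)
    refine h.trans ?_
    have : 5 * |c'| * alpha D * ell D ≤ 5 * |c'| := by
      calc 5 * |c'| * alpha D * ell D = 5 * |c'| * (alpha D * ell D) := by ring
        _ ≤ 5 * |c'| * 1 := by gcongr
        _ = 5 * |c'| := mul_one _
    rw [← hαdef] at this ⊢
    nlinarith [abs_nonneg c']
  have hsK : ‖s‖ ≤ K * α := by nlinarith [abs_nonneg c']
  have hAK : ‖s + βa‖ ≤ K * α := by
    calc ‖s + βa‖ ≤ ‖s‖ + ‖βa‖ := norm_add_le _ _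
      _ ≤ 5 * α / 2 + 3 * α * (1 + 5 * |c'|) := add_le_add hs_hi (hβ _)
      _ ≤ K * α := by nlinarith [abs_nonneg c']
  have hBK : ‖s + βb‖ ≤ K * α := by
    calc ‖s + βb‖ ≤ ‖s‖ + ‖βb‖ := norm_add_le _ _
      _ ≤ 5 * α / 2 + 3 * α * (1 + 5 * |c'|) := add_le_add hs_hi (hβ _)
      _ ≤ K * α := by nlinarith [abs_nonneg c']
  -- Lemma 5.8 at the three points
  have h58 : ∀ z : ℂ, ‖z‖ ≤ K * α → ‖χ.LFunction (1 + z) - ℓ * z‖ ≤ E := by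
    intro z hz
    have hz' : ‖(1 + z) - 1‖ ≤ K * π / Real.log D ^ 9 := by
      rw [add_sub_cancel_left, ← h𝓛def]
      calc ‖z‖ ≤ K * α := hz
        _ = K * π / 𝓛 ^ 9 := by rw [hαeq]; ring
    have h := Lemma58.lemma_5_8_of_le χ hprim h𝓛 hA hKL hz'
    rw [add_sub_cancel_left] at h
    exact h
  have ha : ‖χ.LFunction (1 + s + βa) - ℓ * (s + βa)‖ ≤ E := by
    rw [add_assoc]; exact h58 _ hAK
  have hb : ‖χ.LFunction (1 + s + βb) - ℓ * (s + βb)‖ ≤ E := by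
    rw [add_assoc]; exact h58 _ hBK
  have h0 : ‖χ.LFunction (1 + s) - ℓ * s‖ ≤ E := h58 _ hsK
  -- Lemma 8.3 (iii′) at `1 + s`
  have hu : ‖U (1 + s) - PiW χ d r‖ ≤ C₈₃ * (ell D ^ 8)⁻¹ * hatPi :=
    hU3 _ (by rw [add_sub_cancel_left]; linarith)
  have hE0 : 0 ≤ E := by positivity
  have hEU0 : 0 ≤ C₈₃ * (ell D ^ 8)⁻¹ * hatPi := by
    have h0 : 0 ≤ hatPi := Finset.prod_nonneg fun q hq => by
      have hq2 : (2 : ℝ) ≤ q := by exact_mod_cast (Nat.prime_of_mem_primeFactors hq).two_le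
      have : (q : ℝ)⁻¹ ≤ 1 / 2 := by rw [inv_eq_one_div]; gcongr
      exact inv_nonneg.2 (by linarith)
    positivity
  have hEℓ : E ≤ ℓ₀ * α / 4 := hE
  -- the algebraic comparison
  have hcmp := norm_quot_sub_model_le (u := U (1 + s)) (La := χ.LFunction (1 + s + βa))
    (Lb := χ.LFunction (1 + s + βb)) (L0 := χ.LFunction (1 + s)) (Pv := PiW χ d r) (ℓ := ℓ)
    (s := s) (A := s + βa) (B := s + βb) hα0 hK1 hℓ₀ hℓ hE0 hEU0 hEℓ ha hb h0 hu hs_lo hsK hAK hBK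
  have heq : U (1 - beta6 D + w) * χ.LFunction (1 - beta6 D + w + βa) *
        χ.LFunction (1 - beta6 D + w + βb) / χ.LFunction (1 - beta6 D + w) -
      ℓ * PiW χ d r * ((w - beta6 D + βa) * (w - beta6 D + βb) / (w - beta6 D)) =
      U (1 + s) * χ.LFunction (1 + s + βa) * χ.LFunction (1 + s + βb) / χ.LFunction (1 + s) -
        PiW χ d r * ℓ * (s + βa) * (s + βb) / s := by
    rw [h1s, hsdef]; ring
  rw [heq]
  refine hcmp.trans ?_
  have hPi : ‖PiW χ d r‖ ≤ hatPi ^ 2 := norm_PiW_le_prodInv χ hd hr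
  have hℓle : ‖ℓ‖ ≤ 2 * Real.exp (9 / 2) * (1 + 𝓛) * 𝓛 :=
    Lemma31.norm_deriv_LFunction_le_near_one χ h𝓛 hprim (w := 1)
      (by rw [sub_self, norm_zero]; positivity)
  have hK0 : 0 ≤ 24 * K ^ 2 + 2 * K := by positivity
  gcongr

end ResidueOne

end Literature.NumberTheory.LFunctions.Zhang2022.Lemma84
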